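import Mathlib.Analysis.Fourier.FourierTransformDeriv
import Mathlib.Analysis.Calculus.ParametricIntegral
import Mathlib.Analysis.SpecialFunctions.Exponential
import Mathlib.Analysis.Normed.Algebra.MatrixExponential
import Mathlib.Analysis.Matrix.Normed
import Mathlib.MeasureTheory.Integral.Bochner.Set
import HarnessLib

/-!
# Fourier transforms of time-dependent compactly supported fields: continuity and
differentiation in time, spatial derivatives, constant matrices, and linear ODE uniqueness

Elementary analysis for the Fourier treatment of constant-coefficient first-order systems
`A₀∂ₜv + Σ Aⱼ∂ⱼv + B₁v = 0` with compactly supported classical solutions (the setting of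
[Brenner1973, §5, Lemma 5.1 (5.12): `û(t, ξ) = exp(tP(ξ))û₀(ξ)`] and of the linear step of
[Rauch1986, Proof of Theorem p. 483]): for a field `u : ℝ → ℝᵈ → ℂᵏ` continuous on
`[0, T] × ℝᵈ` and vanishing for `‖x‖ > ρ`,

* `continuousOn_fourier_slice` — `t ↦ 𝓕(u(t))(ξ)` is continuous on `[0, T]` (dominated
  convergence);
* `hasDerivAt_fourier_slice` — if moreover `u` is `C¹` on the slab, then at interior times
  `t ↦ 𝓕(u(t))(ξ)` has derivative `𝓕(∂ₜu(t))(ξ)`, `∂ₜu(t, x) = Du(t, x)(1, 0)`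
  (differentiation under the integral sign, `hasDerivAt_integral_of_dominated_loc_of_deriv_le`);
* `fourier_fderiv_apply_single` — `𝓕(∂ⱼg)(ξ) = 2πiξⱼ 𝓕g(ξ)` for `g ∈ C¹_c(ℝᵈ; ℂᵏ)` (Mathlib's
  `Real.fourier_fderiv`, normalisation `𝓕f(ξ) = ∫ e^{-2πi⟨x,ξ⟩} f`);
  (constant matrices commute with `𝓕`: `Literature.Analysis.Fourier.fourier_mulVec`,
  `LpMultiplierConstant.lean`);
* `eq_exp_neg_mulVec_of_hasDerivAt` — uniqueness for `w' = -Gw` on `[0, T]`: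
  a solution continuous on `[0, T]` with the equation at interior times is `w(t) = e^{-tG}w(0)`
  (`e^{tG}w(t)` has zero derivative);
* the complexification `ofRealPi : ℝᵏ →L[ℝ] ℂᵏ`, `cplx f = ofRealPi ∘ f`, and its interaction
  with derivatives and real matrices.

## References

* [Brenner1973] P. Brenner, Ark. Mat. 11 (1973) 75–101, §5 p. 92 and Lemma 5.1 p. 96.
* [Rauch1986] J. Rauch, Comm. Math. Phys. 106 (1986) 481–484, Proof of Theorem p. 483.
-/

noncomputable section

open MeasureTheory Set Filter Matrix Metric FourierTransform
open scoped Topology RealInnerProductSpace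

namespace Literature.Analysis.Fourier

variable {d k : ℕ}

/-! ### Complexification of `ℝᵏ`-valued maps -/

/-- Componentwise complexification `ℝᵏ → ℂᵏ` as a real continuous linear map. [folklore] -/
def ofRealPi : (Fin k → ℝ) →L[ℝ] (Fin k → ℂ) :=
  ContinuousLinearMap.pi fun i => Complex.ofRealCLM.comp (ContinuousLinearMap.proj i)

/-- `ofRealPi y i = y i`. [folklore] -/
@[simp] theorem ofRealPi_apply (y : Fin k → ℝ) (i : Fin k) : ofRealPi y i = (y i : ℂ) := rfl

/-- Complexification commutes with real matrices: `(My)_ℂ = M_ℂ y_ℂ`. [folklore] -/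
theorem ofRealPi_mulVec (M : Matrix (Fin k) (Fin k) ℝ) (y : Fin k → ℝ) :
    ofRealPi (M *ᵥ y) = M.map (algebraMap ℝ ℂ) *ᵥ ofRealPi y := by
  ext i
  simp [Matrix.mulVec, dotProduct, Matrix.map_apply]

/-- Complexification of a vector field on `ℝᵈ`. [folklore] -/
def cplx (f : EuclideanSpace ℝ (Fin d) → Fin k → ℝ) : EuclideanSpace ℝ (Fin d) → Fin k → ℂ :=
  fun x => ofRealPi (f x)

/-- Unfolding `cplx`. [folklore] -/
theorem cplx_apply (f : EuclideanSpace ℝ (Fin d) → Fin k → ℝ) (x : EuclideanSpace ℝ (Fin d)) :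
    cplx f x = ofRealPi (f x) := rfl

/-- `cplx f = ofRealPi ∘ f`. [folklore] -/
theorem cplx_eq_comp (f : EuclideanSpace ℝ (Fin d) → Fin k → ℝ) : cplx f = ofRealPi ∘ f := rfl

/-- Complexification preserves smoothness. [folklore] -/
theorem ContDiff.cplx {n : WithTop ℕ∞} {f : EuclideanSpace ℝ (Fin d) → Fin k → ℝ}
    (hf : ContDiff ℝ n f) : ContDiff ℝ n (cplx f) :=
  ofRealPi.contDiff.comp hf

/-- Complexification preserves compact support. [folklore] -/
theorem HasCompactSupport.cplx {f : EuclideanSpace ℝ (Fin d) → Fin k → ℝ}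
    (hf : HasCompactSupport f) : HasCompactSupport (cplx f) :=
  hf.comp_left (map_zero ofRealPi)

/-- The derivative of the complexification is the complexified derivative. [folklore] -/
theorem fderiv_cplx_apply {f : EuclideanSpace ℝ (Fin d) → Fin k → ℝ} {x : EuclideanSpace ℝ (Fin d)}
    (hf : DifferentiableAt ℝ f x) (h : EuclideanSpace ℝ (Fin d)) :
    fderiv ℝ (cplx f) x h = ofRealPi (fderiv ℝ f x h) := by
  rw [cplx_eq_comp, (ofRealPi.hasFDerivAt.comp x hf.hasFDerivAt).fderiv]
  rfl

/-! ### Spatial derivatives and constant matrices under the Fourier transform -/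

/-- `M ↦ Mv` as a complex-linear continuous map. [folklore] -/
def mulVecCLM (M : Matrix (Fin k) (Fin k) ℂ) : (Fin k → ℂ) →L[ℂ] (Fin k → ℂ) :=
  LinearMap.toContinuousLinearMap (Matrix.mulVecLin M)

/-- Unfolding `mulVecCLM`. [folklore] -/
@[simp] theorem mulVecCLM_apply (M : Matrix (Fin k) (Fin k) ℂ) (v : Fin k → ℂ) :
    mulVecCLM M v = M *ᵥ v := rfl

/-- **`𝓕(∂ⱼg)(ξ) = 2πiξⱼ · 𝓕g(ξ)`** for a `C¹` compactly supported `ℂᵏ`-valued map on `ℝᵈ`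
(`∂ⱼg = Dg(·)eⱼ`; Mathlib's normalisation `𝓕g(ξ) = ∫ e^{-2πi⟨x, ξ⟩} g(x) dx`).
[cite: Brenner1973, §1 p. 78] -/
theorem fourier_fderiv_apply_single {g : EuclideanSpace ℝ (Fin d) → Fin k → ℂ}
    (hg : ContDiff ℝ 1 g) (hc : HasCompactSupport g) (ξ : EuclideanSpace ℝ (Fin d)) (j : Fin d) :
    𝓕 (fun x => fderiv ℝ g x (EuclideanSpace.single j 1)) ξ =
      (2 * Real.pi * ξ j * Complex.I) • 𝓕 g ξ := by
  have hint : Integrable g := hg.continuous.integrable_of_hasCompactSupport hc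
  have hdiff : Differentiable ℝ g := hg.differentiable one_ne_zero
  have hint' : Integrable (fderiv ℝ g) :=
    (hg.continuous_fderiv one_ne_zero).integrable_of_hasCompactSupport (hc.fderiv ℝ)
  rw [← Real.fourier_continuousLinearMap_apply hint', Real.fourier_fderiv hint hdiff hint',
    VectorFourier.fourierSMulRight_apply,
    show ((-innerSL ℝ) ξ) (EuclideanSpace.single j 1) = -⟪ξ, EuclideanSpace.single j (1 : ℝ)⟫ from rfl,
    EuclideanSpace.inner_single_right]
  simp only [one_mul, conj_trivial]
  rw [← Complex.coe_smul (-(ξ j)), smul_smul]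
  congr 1
  push_cast
  ring

/-! ### Time-dependent fields: continuity and differentiation under the integral sign -/

section Parametric

variable {u : ℝ → EuclideanSpace ℝ (Fin d) → Fin k → ℂ} {T ρ : ℝ}

/-- The Fourier kernel `v ↦ 𝐞(-⟨v, ξ⟩)` is continuous. [folklore] -/
theorem continuous_fourierKernel (ξ : EuclideanSpace ℝ (Fin d)) :
    Continuous fun v : EuclideanSpace ℝ (Fin d) => (𝐞 (-⟪v, ξ⟫) : Circle) :=
  Real.continuous_fourierChar.comp (continuous_id.inner continuous_const).neg

/-- Slices of a field continuous on the slab are continuous. [folklore] -/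
theorem continuous_slice (hcont : ContinuousOn (Function.uncurry u) (Icc 0 T ×ˢ univ)) {t : ℝ}
    (ht : t ∈ Icc 0 T) : Continuous (u t) :=
  (hcont.comp_continuous (continuous_const.prodMk continuous_id) fun x => ⟨ht, mem_univ x⟩ :)

/-- A uniform bound `‖u(t, x)‖ ≤ C` on the slab, for a field continuous on `[0, T] × ℝᵈ` and
vanishing for `‖x‖ > ρ`. [folklore] -/
theorem exists_bound_of_slab (hcont : ContinuousOn (Function.uncurry u) (Icc 0 T ×ˢ univ))
    (hsupp : ∀ t ∈ Icc 0 T, ∀ x : EuclideanSpace ℝ (Fin d), ρ < ‖x‖ → u t x = 0) :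
    ∃ C : ℝ, 0 ≤ C ∧ ∀ t ∈ Icc 0 T, ∀ x, ‖u t x‖ ≤ C := by
  have hK : IsCompact (Icc 0 T ×ˢ closedBall (0 : EuclideanSpace ℝ (Fin d)) ρ) :=
    isCompact_Icc.prod (isCompact_closedBall _ _)
  obtain ⟨C, hC⟩ := hK.exists_bound_of_continuousOn
    (hcont.mono (prod_mono subset_rfl (subset_univ _)))
  refine ⟨max C 0, le_max_right _ _, fun t ht x => ?_⟩
  by_cases hx : ‖x‖ ≤ ρ
  · exact (hC (t, x) ⟨ht, mem_closedBall_zero_iff.2 hx⟩).trans (le_max_left _ _)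
  · rw [hsupp t ht x (lt_of_not_ge hx), norm_zero]
    exact le_max_right _ _

/-- **Continuity in time of the Fourier transform of the slices**: for `u` continuous on
`[0, T] × ℝᵈ` and vanishing for `‖x‖ > ρ`, `t ↦ 𝓕(u(t))(ξ)` is continuous on `[0, T]`
(dominated convergence, dominating function `C·𝟙_{‖x‖ ≤ ρ}`). [folklore] -/
theorem continuousOn_fourier_slice (hcont : ContinuousOn (Function.uncurry u) (Icc 0 T ×ˢ univ))
    (hsupp : ∀ t ∈ Icc 0 T, ∀ x : EuclideanSpace ℝ (Fin d), ρ < ‖x‖ → u t x = 0)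
    (ξ : EuclideanSpace ℝ (Fin d)) : ContinuousOn (fun t => 𝓕 (u t) ξ) (Icc 0 T) := by
  obtain ⟨C, -, hC⟩ := exists_bound_of_slab hcont hsupp
  simp_rw [Real.fourier_eq]
  refine continuousOn_of_dominated (bound := (closedBall (0 : EuclideanSpace ℝ (Fin d)) ρ).indicator
    fun _ => C) ?_ ?_ ?_ ?_
  · intro t ht
    exact ((continuous_fourierKernel ξ).smul (continuous_slice hcont ht)).aestronglyMeasurable
  · intro t ht
    refine Eventually.of_forall fun x => ?_
    rw [Circle.norm_smul]
    by_cases hx : x ∈ closedBall (0 : EuclideanSpace ℝ (Fin d)) ρ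
    · rw [indicator_of_mem hx]
      exact hC t ht x
    · rw [indicator_of_notMem hx, hsupp t ht x (by rwa [mem_closedBall_zero_iff, not_le] at hx),
        norm_zero]
  · exact (integrableOn_const (measure_closedBall_lt_top.ne)).integrable_indicator
      measurableSet_closedBall
  · refine Eventually.of_forall fun x => ?_
    exact ((continuousOn_const (c := (𝐞 (-⟪x, ξ⟫) : Circle))).smul
      (hcont.comp (continuous_id.prodMk continuous_const).continuousOn
        fun t ht => ⟨ht, mem_univ x⟩) :)

/-- The time derivative `∂ₜu(t, x) = Du(t, x)(1, 0)` of a field on the slab. [folklore] -/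
def timeDeriv (u : ℝ → EuclideanSpace ℝ (Fin d) → Fin k → ℂ) (t : ℝ)
    (x : EuclideanSpace ℝ (Fin d)) : Fin k → ℂ :=
  fderiv ℝ (Function.uncurry u) (t, x) (1, 0)

/-- Unfolding `timeDeriv`. [folklore] -/
theorem timeDeriv_apply (u : ℝ → EuclideanSpace ℝ (Fin d) → Fin k → ℂ) (t : ℝ)
    (x : EuclideanSpace ℝ (Fin d)) : timeDeriv u t x = fderiv ℝ (Function.uncurry u) (t, x) (1, 0) :=
  rfl

/-- At interior times a `C¹` field on the slab is differentiable. [folklore] -/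
theorem differentiableAt_uncurry_of_slab (hdiff : ContDiffOn ℝ 1 (Function.uncurry u) (Icc 0 T ×ˢ univ))
    {t : ℝ} (ht : t ∈ Ioo 0 T) (x : EuclideanSpace ℝ (Fin d)) :
    DifferentiableAt ℝ (Function.uncurry u) (t, x) := by
  have hmem : (t, x) ∈ Icc 0 T ×ˢ (univ : Set (EuclideanSpace ℝ (Fin d))) :=
    ⟨Ioo_subset_Icc_self ht, mem_univ _⟩
  have hn : Icc 0 T ×ˢ (univ : Set (EuclideanSpace ℝ (Fin d))) ∈ 𝓝 (t, x) :=
    prod_mem_nhds (Icc_mem_nhds ht.1 ht.2) univ_mem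
  exact (hdiff.differentiableOn one_ne_zero _ hmem).differentiableAt hn

/-- At interior times the slice `t ↦ u(t, x)` has derivative `∂ₜu(t, x)`. [folklore] -/
theorem hasDerivAt_slice (hdiff : ContDiffOn ℝ 1 (Function.uncurry u) (Icc 0 T ×ˢ univ))
    {t : ℝ} (ht : t ∈ Ioo 0 T) (x : EuclideanSpace ℝ (Fin d)) :
    HasDerivAt (fun s => u s x) (timeDeriv u t x) t := by
  have h1 : HasDerivAt (fun s : ℝ => ((s, x) : ℝ × EuclideanSpace ℝ (Fin d))) (1, 0) t :=
    (hasDerivAt_id t).prodMk (hasDerivAt_const t x)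
  exact ((differentiableAt_uncurry_of_slab hdiff ht x).hasFDerivAt.comp_hasDerivAt t h1 :)

/-- Outside the support radius the time derivative vanishes (interior times). [folklore] -/
theorem timeDeriv_eq_zero_of_norm_gt (hsupp : ∀ t ∈ Icc 0 T, ∀ x : EuclideanSpace ℝ (Fin d),
      ρ < ‖x‖ → u t x = 0) {t : ℝ} (ht : t ∈ Ioo 0 T) {x : EuclideanSpace ℝ (Fin d)} (hx : ρ < ‖x‖) :
    timeDeriv u t x = 0 := by
  have ho : IsOpen (Ioo 0 T ×ˢ {y : EuclideanSpace ℝ (Fin d) | ρ < ‖y‖}) :=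
    isOpen_Ioo.prod (isOpen_lt continuous_const continuous_norm)
  have heq : Function.uncurry u =ᶠ[𝓝 (t, x)] fun _ => 0 :=
    Filter.eventuallyEq_of_mem (ho.mem_nhds ⟨ht, hx⟩)
      fun p hp => hsupp p.1 (Ioo_subset_Icc_self hp.1) p.2 hp.2
  rw [timeDeriv, heq.fderiv_eq, fderiv_const_apply]
  rfl

/-- A uniform bound `‖∂ₜu(t, x)‖ ≤ C` at interior times, for a `C¹` field on the slab
vanishing for `‖x‖ > ρ`. [folklore] -/
theorem exists_bound_timeDeriv (hT : 0 < T)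
    (hdiff : ContDiffOn ℝ 1 (Function.uncurry u) (Icc 0 T ×ˢ univ))
    (hsupp : ∀ t ∈ Icc 0 T, ∀ x : EuclideanSpace ℝ (Fin d), ρ < ‖x‖ → u t x = 0) :
    ∃ C : ℝ, 0 ≤ C ∧ ∀ t ∈ Ioo 0 T, ∀ x, ‖timeDeriv u t x‖ ≤ C := by
  have hU : UniqueDiffOn ℝ (Icc 0 T ×ˢ (univ : Set (EuclideanSpace ℝ (Fin d)))) :=
    (uniqueDiffOn_Icc hT).prod uniqueDiffOn_univ
  have hcontD : ContinuousOn (fderivWithin ℝ (Function.uncurry u) (Icc 0 T ×ˢ univ))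
      (Icc 0 T ×ˢ univ) := hdiff.continuousOn_fderivWithin hU le_rfl
  have hK : IsCompact (Icc 0 T ×ˢ closedBall (0 : EuclideanSpace ℝ (Fin d)) ρ) :=
    isCompact_Icc.prod (isCompact_closedBall _ _)
  obtain ⟨C, hC⟩ := hK.exists_bound_of_continuousOn
    (hcontD.mono (prod_mono subset_rfl (subset_univ _)))
  refine ⟨max C 0, le_max_right _ _, fun t ht x => ?_⟩
  by_cases hx : ‖x‖ ≤ ρ
  · have hmem : (t, x) ∈ Icc 0 T ×ˢ closedBall (0 : EuclideanSpace ℝ (Fin d)) ρ :=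
      ⟨Ioo_subset_Icc_self ht, mem_closedBall_zero_iff.2 hx⟩
    have hint : Icc 0 T ×ˢ (univ : Set (EuclideanSpace ℝ (Fin d))) ∈ 𝓝 (t, x) :=
      prod_mem_nhds (Icc_mem_nhds ht.1 ht.2) univ_mem
    have hfd : fderiv ℝ (Function.uncurry u) (t, x) =
        fderivWithin ℝ (Function.uncurry u) (Icc 0 T ×ˢ univ) (t, x) :=
      (fderivWithin_of_mem_nhds hint).symm
    have hCb : ‖fderiv ℝ (Function.uncurry u) (t, x)‖ ≤ C := by rw [hfd]; exact hC _ hmem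
    have h10 : ‖((1 : ℝ), (0 : EuclideanSpace ℝ (Fin d)))‖ ≤ 1 := by simp [Prod.norm_def]
    calc ‖timeDeriv u t x‖ = ‖fderiv ℝ (Function.uncurry u) (t, x) (1, 0)‖ := rfl
      _ ≤ ‖fderiv ℝ (Function.uncurry u) (t, x)‖ * ‖((1 : ℝ), (0 : EuclideanSpace ℝ (Fin d)))‖ :=
          ContinuousLinearMap.le_opNorm _ _
      _ ≤ C * 1 := mul_le_mul hCb h10 (norm_nonneg _) ((norm_nonneg _).trans hCb)
      _ ≤ max C 0 := by rw [mul_one]; exact le_max_left _ _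
  · rw [timeDeriv_eq_zero_of_norm_gt hsupp ht (lt_of_not_ge hx), norm_zero]
    exact le_max_right _ _

/-- **Differentiation under the integral sign, in time**: for `u` of class `C¹` on
`[0, T] × ℝᵈ`, vanishing for `‖x‖ > ρ`, and an interior time `t₀`, the function `t ↦ 𝓕(u(t))(ξ)`
has derivative `𝓕(∂ₜu(t₀))(ξ)` at `t₀`. [folklore] -/
theorem hasDerivAt_fourier_slice (hdiff : ContDiffOn ℝ 1 (Function.uncurry u) (Icc 0 T ×ˢ univ))
    (hsupp : ∀ t ∈ Icc 0 T, ∀ x : EuclideanSpace ℝ (Fin d), ρ < ‖x‖ → u t x = 0)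
    {t₀ : ℝ} (ht₀ : t₀ ∈ Ioo 0 T) (ξ : EuclideanSpace ℝ (Fin d)) :
    HasDerivAt (fun t => 𝓕 (u t) ξ) (𝓕 (timeDeriv u t₀) ξ) t₀ := by
  have hT : 0 < T := ht₀.1.trans ht₀.2
  have hcont : ContinuousOn (Function.uncurry u) (Icc 0 T ×ˢ univ) := hdiff.continuousOn
  obtain ⟨C, -, hC⟩ := exists_bound_timeDeriv hT hdiff hsupp
  simp_rw [Real.fourier_eq]
  -- the integrands, with the circle action spelled out as a complex scalar
  set F : ℝ → EuclideanSpace ℝ (Fin d) → (Fin k → ℂ) :=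
    fun t x => ((𝐞 (-⟪x, ξ⟫) : Circle) : ℂ) • u t x with hF
  set F' : ℝ → EuclideanSpace ℝ (Fin d) → (Fin k → ℂ) :=
    fun t x => ((𝐞 (-⟪x, ξ⟫) : Circle) : ℂ) • timeDeriv u t x with hF'
  have hFeq : ∀ t, (fun x : EuclideanSpace ℝ (Fin d) => 𝐞 (-⟪x, ξ⟫) • u t x) = F t := by
    intro t; funext x; rw [hF, Circle.smul_def]
  have hF'eq : (fun x : EuclideanSpace ℝ (Fin d) => 𝐞 (-⟪x, ξ⟫) • timeDeriv u t₀ x) = F' t₀ := by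
    funext x; rw [hF', Circle.smul_def]
  simp_rw [hFeq]
  rw [hF'eq]
  have hkc : Continuous fun x : EuclideanSpace ℝ (Fin d) => ((𝐞 (-⟪x, ξ⟫) : Circle) : ℂ) :=
    continuous_subtype_val.comp (continuous_fourierKernel ξ)
  have hs : Ioo 0 T ∈ 𝓝 t₀ := Ioo_mem_nhds ht₀.1 ht₀.2
  refine (hasDerivAt_integral_of_dominated_loc_of_deriv_le (μ := volume) (F := F) (F' := F') (x₀ := t₀)
    (bound := (closedBall (0 : EuclideanSpace ℝ (Fin d)) ρ).indicator fun _ => C) hs ?_ ?_ ?_ ?_ ?_ ?_).2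
  · -- measurability of `F t` near `t₀`
    refine Filter.eventually_of_mem hs fun t ht => ?_
    exact (hkc.smul (continuous_slice hcont (Ioo_subset_Icc_self ht))).aestronglyMeasurable
  · -- integrability of `F t₀` (continuous, compactly supported)
    refine (hkc.smul (continuous_slice hcont (Ioo_subset_Icc_self ht₀))).integrable_of_hasCompactSupport ?_
    refine HasCompactSupport.intro (isCompact_closedBall (0 : EuclideanSpace ℝ (Fin d)) ρ) fun x hx => ?_
    rw [mem_closedBall_zero_iff, not_le] at hx
    change ((𝐞 (-⟪x, ξ⟫) : Circle) : ℂ) • u t₀ x = 0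
    rw [hsupp t₀ (Ioo_subset_Icc_self ht₀) x hx, smul_zero]
  · -- measurability of `F' t₀`: `∂ₜu(t₀, ·)` is continuous (interior time)
    have ho : IsOpen (Ioo 0 T ×ˢ (univ : Set (EuclideanSpace ℝ (Fin d)))) := isOpen_Ioo.prod isOpen_univ
    have hcD : ContinuousOn (fderiv ℝ (Function.uncurry u)) (Ioo 0 T ×ˢ univ) :=
      (hdiff.mono (prod_mono Ioo_subset_Icc_self subset_rfl)).continuousOn_fderiv_of_isOpen ho le_rfl
    have h1 : Continuous fun x : EuclideanSpace ℝ (Fin d) => fderiv ℝ (Function.uncurry u) (t₀, x) :=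
      (hcD.comp_continuous (continuous_const.prodMk continuous_id) fun x => ⟨ht₀, mem_univ x⟩ :)
    have h2 : Continuous fun x : EuclideanSpace ℝ (Fin d) => timeDeriv u t₀ x :=
      (ContinuousLinearMap.apply ℝ (Fin k → ℂ) ((1 : ℝ), (0 : EuclideanSpace ℝ (Fin d)))).continuous.comp h1
    exact (hkc.smul h2).aestronglyMeasurable
  · -- the bound `‖F' t x‖ ≤ C 𝟙_{‖x‖ ≤ ρ}` for interior `t`
    refine Eventually.of_forall fun x t ht => ?_
    change ‖((𝐞 (-⟪x, ξ⟫) : Circle) : ℂ) • timeDeriv u t x‖ ≤ _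
    rw [← Circle.smul_def, Circle.norm_smul]
    by_cases hx : x ∈ closedBall (0 : EuclideanSpace ℝ (Fin d)) ρ
    · rw [indicator_of_mem hx]
      exact hC t ht x
    · rw [indicator_of_notMem hx, timeDeriv_eq_zero_of_norm_gt hsupp ht
        (by rwa [mem_closedBall_zero_iff, not_le] at hx), norm_zero]
  · exact (integrableOn_const (measure_closedBall_lt_top.ne)).integrable_indicator
      measurableSet_closedBall
  · -- pointwise time derivative
    refine Eventually.of_forall fun x t ht => ?_
    exact (hasDerivAt_slice hdiff ht x).const_smul (((𝐞 (-⟪x, ξ⟫) : Circle) : ℂ))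

end Parametric

/-! ### Uniqueness for `w' = -Gw` on an interval -/

section ODE

open scoped Matrix.Norms.Operator

/-- `(M, v) ↦ Mv` as a real-bilinear continuous map. [folklore] -/
def mulVecBilin : Matrix (Fin k) (Fin k) ℂ →L[ℝ] (Fin k → ℂ) →L[ℝ] (Fin k → ℂ) :=
  LinearMap.toContinuousLinearMap
    { toFun := fun M => (mulVecCLM M).restrictScalars ℝ
      map_add' := fun M N => by ext v i; simp [Matrix.add_mulVec]
      map_smul' := fun c M => by ext v i; simp [Matrix.smul_mulVec] }

/-- Unfolding `mulVecBilin`. [folklore] -/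
@[simp] theorem mulVecBilin_apply (M : Matrix (Fin k) (Fin k) ℂ) (v : Fin k → ℂ) :
    mulVecBilin M v = M *ᵥ v := rfl

/-- **Uniqueness for the linear constant-coefficient ODE `w' = -Gw` on `[0, T]`**: if `w` is
continuous on `[0, T]` and `w'(t) = -Gw(t)` at interior times, then `w(t) = e^{-tG}w(0)` on
`[0, T]` — `z(t) = e^{tG}w(t)` has zero derivative on `(0, T)`, hence is constant there and,
by continuity, on `[0, T]`. [cite: Brenner1973, Lemma 5.1 (5.12) p. 96] -/
theorem eq_exp_neg_mulVec_of_hasDerivAt {w : ℝ → Fin k → ℂ} {G : Matrix (Fin k) (Fin k) ℂ} {T : ℝ}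
    (hwc : ContinuousOn w (Icc 0 T)) (hwd : ∀ t ∈ Ioo 0 T, HasDerivAt w (-(G *ᵥ w t)) t) {t : ℝ}
    (ht : t ∈ Icc 0 T) : w t = NormedSpace.exp (-(t : ℂ) • G) *ᵥ w 0 := by
  -- `z(t) = e^{tG} w(t)`
  set z : ℝ → Fin k → ℂ := fun s => NormedSpace.exp (s • G) *ᵥ w s with hz
  have hexpd : ∀ s : ℝ, HasDerivAt (fun s : ℝ => mulVecBilin (NormedSpace.exp (s • G)))
      (mulVecBilin (G * NormedSpace.exp (s • G))) s := fun s =>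
    mulVecBilin.hasFDerivAt.comp_hasDerivAt s (hasDerivAt_exp_smul_const' (𝕂 := ℝ) G s)
  have hzd : ∀ s ∈ Ioo 0 T, HasDerivAt z 0 s := by
    intro s hs
    have h := (hexpd s).clm_apply (hwd s hs)
    have hcomm : G * NormedSpace.exp (s • G) = NormedSpace.exp (s • G) * G :=
      (((Commute.refl G).smul_right s).exp_right).eq
    have hval : mulVecBilin (G * NormedSpace.exp (s • G)) (w s) +
        mulVecBilin (NormedSpace.exp (s • G)) (-(G *ᵥ w s)) = 0 := by
      rw [mulVecBilin_apply, mulVecBilin_apply, hcomm, mulVec_neg, ← mulVec_mulVec, add_neg_cancel]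
    rw [hval] at h
    exact h
  have hexpc : Continuous fun s : ℝ => NormedSpace.exp (s • G) :=
    NormedSpace.exp_continuous.comp (continuous_id.smul continuous_const)
  have hzc : ContinuousOn z (Icc 0 T) :=
    (mulVecBilin.continuous₂.comp_continuousOn (hexpc.continuousOn.prodMk hwc) :)
  -- `z` is constant on `(0, T)`, hence on `[0, T]`
  have hz0 : ∀ s ∈ Icc 0 T, z s = z 0 := by
    rcases lt_or_ge 0 T with hT | hT
    · have hconst : ∀ x ∈ Ioo 0 T, ∀ y ∈ Ioo 0 T, z x = z y := fun x hx y hy =>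
        isOpen_Ioo.is_const_of_deriv_eq_zero isPreconnected_Ioo
          (fun s hs => (hzd s hs).differentiableAt.differentiableWithinAt)
          (fun s hs => (hzd s hs).deriv) hx hy
      have hmid : T / 2 ∈ Ioo 0 T := ⟨by linarith, by linarith⟩
      have heq : EqOn z (fun _ => z (T / 2)) (Icc 0 T) := by
        refine EqOn.of_subset_closure (s := Ioo 0 T) (fun x hx => hconst x hx _ hmid) hzc
          continuousOn_const Ioo_subset_Icc_self ?_
        rw [closure_Ioo hT.ne]
      intro s hs
      rw [heq hs, heq (left_mem_Icc.2 hT.le)]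
    · intro s hs
      have hs0 : s = 0 := le_antisymm (hs.2.trans hT) hs.1
      rw [hs0]
  have hzt := hz0 t ht
  simp only [hz, zero_smul, NormedSpace.exp_zero, one_mulVec] at hzt
  -- invert `e^{tG}`
  have hinv : NormedSpace.exp (-(t : ℂ) • G) * NormedSpace.exp (t • G) = 1 := by
    rw [← Complex.coe_smul,
      ← Matrix.exp_add_of_commute _ _ (((Commute.refl G).smul_left _).smul_right _), ← add_smul,
      neg_add_cancel, zero_smul, NormedSpace.exp_zero]
  calc w t = (NormedSpace.exp (-(t : ℂ) • G) * NormedSpace.exp (t • G)) *ᵥ w t := by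
        rw [hinv, one_mulVec]
    _ = NormedSpace.exp (-(t : ℂ) • G) *ᵥ w 0 := by rw [← mulVec_mulVec, hzt]

end ODE

end Literature.Analysis.Fourier

end
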